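import Summits.ABC.IUTFork.LanaLogLinkLiftingChecks
import HarnessLib

/-!
# L-LANA objects IX quinquies: `UniqueLifting` at the `ℚ_p` datum from two NAMED facts (Prop. 3.2 (iv) injectivity + [IUTchII] Rmk. 1.11.1 (i) (a))

Record-only sequel (D-0012; seat abc-iut-c312-4, L-LANA level, plan/LLANA-SPEC N12) of `LanaLogLinkLifting.lean` /
`LanaLogLinkLiftingChecks.lean`; TAKES NO SIDE on [IUTchIII] Cor. 3.12. There: `UniqueLifting ref ⟺ LiftExists ∧
LiftUnique` at each reference datum; at the `ℚ_p` datum `padicRef` (`K̄_v = ℚ̄_p`, placeholder `Π_v := G_v`) the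
uniqueness half follows from L4's named [AbsTopIII] Prop. 3.2 (iv) injectivity `PairIsoDeterminedByGalois` ALONE, while
the existence half was left to the HYPERBOLIC-ORBICURVE form `GaloisIsoLiftsToTMPairIso H` — which does not apply to
`padicRef` (of mono-analytic type: `Π_v = G_v`). L4 also typed the MONO-ANALYTIC lifting statement
`GaloisIsoLiftsToTMPairIsoOfMonoAnalytic` ([IUTchII] Rmk. 1.11.1 (i) (a), kurims p. 50: for `G ↷ 𝒪^⊳(G)` "the group of
automorphisms … maps bijectively … onto the group of automorphisms of the topological group `G`"; mechanism [AbsTopIII]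
Cor. 1.10 functoriality; a named `Prop`, NOT proved in the tree). THIS file:

* `isOfMonoAnalyticTypeMonoid_padicPair` — the `ℚ_p` reference pair IS of mono-analytic type (Def. 3.1 (ii); via
  `padicPairIsoModel` to L4's `ModelMLFGaloisData.galois … |>.tmPair`, `ε = id`);
* `padicRef_liftExists_of_monoAnalytic` — the EXISTENCE half at `ℚ_p` from `GaloisIsoLiftsToTMPairIsoOfMonoAnalytic`
  plus the continuity clause `hcont` of `LanaLogLinkLifting` (LANA Def. 3.7.1 isomorphisms are homeomorphisms on `O^▷`;
  L4 omits the topology of `M`);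
* **`uniqueLifting_padicRef_of_named`** — for ANY index set of places all carrying the `ℚ_p` datum, LANA's
  `UniqueLifting` follows from the two named facts + `hcont`. So at this datum the N12 hypothesis of `LanaLogTheta.lean`
  is EXACTLY: [AbsTopIII] Prop. 3.2 (iv) (injectivity) ∧ [IUTchII] Rmk. 1.11.1 (i) (a) ∧ "lifted isomorphisms are
  continuous on `O^▷`".

[cite: LANA2026Report, §5.3 (a) p. 29] [cite: MochizukiAbsTopIII2015, Proposition 3.2 (iv) p.72]
[cite: Mochizuki2012, II Rmk 1.11.1 (i) p.50] NOT here: any judgement.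
-/

noncomputable section

namespace Summit.ABC
namespace IUTFork

open Literature.AnabelianGeometry.AbsoluteAnabelian
open scoped NNReal

variable (p : ℕ) [Fact p.Prime]

/-- **The `ℚ_p` reference pair is of mono-analytic type** ([AbsTopIII] Def. 3.1 (ii): "if `ε_k` is an isomorphism"):
it is isomorphic (`padicPairIsoModel`) to the model `TM`-pair of the mono-analytic model data `(ℚ_p, ℚ̄_p, id)`.
[cite: MochizukiAbsTopIII2015, Definition 3.1 (ii) p.67] -/
theorem isOfMonoAnalyticTypeMonoid_padicPair : IsOfMonoAnalyticTypeMonoid .TM (padicPair p) :=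
  ⟨⟨MLFClosure.padic p, ModelMLFGaloisData.galois ℚ_[p] (PadicAlgCl p), _,
    ⟨ModelMLFGaloisData.galois_aug_bijective _ _, ModelMLFGaloisData.galois_aug_isOpenMap _ _⟩,
    (ModelMLFGaloisData.galois ℚ_[p] (PadicAlgCl p)).monoidPair_TM, ⟨padicPairIsoModel p⟩⟩⟩

/-- **The existence half of the unique lifting at the `ℚ_p` datum FROM [IUTchII] Rmk. 1.11.1 (i) (a)** (L4's named
`GaloisIsoLiftsToTMPairIsoOfMonoAnalytic`, NOT proved in the tree) and the continuity clause: every topological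
automorphism of `G_{ℚ_p}` extends to an automorphism of the GM-data `(G_{ℚ_p} ↷ O^▷_{ℚ̄_p})`.
[cite: Mochizuki2012, II Rmk 1.11.1 (i) p.50] [cite: LANA2026Report, §5.3 (a) p. 29] -/
theorem padicRef_liftExists_of_monoAnalytic (hlift : GaloisIsoLiftsToTMPairIsoOfMonoAnalytic)
    (hcont : ∀ e : GaloisMonoidPair.Iso (padicPair p) (padicPair p), Continuous e.isoM ∧ Continuous e.isoM.symm) :
    (padicRef p).LiftExists := by
  intro f
  obtain ⟨e, he⟩ := hlift _ _ (isMLFGaloisMonoidPair_padicPair p) (isMLFGaloisMonoidPair_padicPair p)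
    (isOfMonoAnalyticTypeMonoid_padicPair p) (isOfMonoAnalyticTypeMonoid_padicPair p) f
  letI := (padicRef p).holAction
  let eM : (padicRef p).Fhol.M ≃ₜ* (padicRef p).Fhol.M :=
    { e.isoM with continuous_toFun := (hcont e).1, continuous_invFun := (hcont e).2 }
  have heM : ∀ a, eM a = e.isoM a := fun _ => rfl
  refine ⟨⟨f, eM, fun g a => ?_⟩, rfl⟩
  have h := e.smul_comm g a
  rw [he] at h
  rw [heM, heM]
  exact h

/-- **`UniqueLifting` at the `ℚ_p` datum from the two NAMED facts**: for a family of places all carrying the `ℚ_p`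
reference datum, LANA's unique lifting of the log-link holds granted [AbsTopIII] Prop. 3.2 (iv) injectivity
(`PairIsoDeterminedByGalois`), [IUTchII] Rmk. 1.11.1 (i) (a) (`GaloisIsoLiftsToTMPairIsoOfMonoAnalytic`) and the
continuity clause. [cite: LANA2026Report, §5.3 (a) p. 29] [cite: MochizukiAbsTopIII2015, Proposition 3.2 (iv) p.72]
[cite: Mochizuki2012, II Rmk 1.11.1 (i) p.50] -/
theorem uniqueLifting_padicRef_of_named {V : Type} (hdet : PairIsoDeterminedByGalois)
    (hlift : GaloisIsoLiftsToTMPairIsoOfMonoAnalytic)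
    (hcont : ∀ e : GaloisMonoidPair.Iso (padicPair p) (padicPair p), Continuous e.isoM ∧ Continuous e.isoM.symm) :
    UniqueLifting (fun _ : V => padicRef p) :=
  uniqueLifting_of_ref (fun _ => padicRef_liftExists_of_monoAnalytic p hlift hcont)
    (fun _ => padicRef_liftUnique_of_pairIsoDeterminedByGalois p hdet)

end IUTFork

end Summit.ABC

end
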